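import Summits.CriticalPhenomena.PercolationContinuityZ3.Theorems.PercNearOneGluingNoHeavyQuantZeroOneK4Cells
import Summits.CriticalPhenomena.PercolationContinuityZ3.Theorems.PercNearOneGluingNoHeavyQuantFarProfileRows
import HarnessLib

/-!
# `Z(3,2)` (`OneCutFive.ZeroOneThree`) HOLDS ON EVERY WEIGHTED GRAPH WITH AT MOST FOUR VERTICES

builds on p205010 (kernel theorem, internal audit signed; external expert review pending)

Support file (`--supports stmt-CriticalPhenomena-4575`), seat `prim-quant-p1` (gen 3); memo `run/shared/lean/prim/quant/P1-SURPLUS.md` §13.8–13.10.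
No definitions, no named facts, no sorries; standard axioms.

`OneCutFive.ZeroOneThree` (open): for an observer `o` and three relays `a, b, c` with `Σ_v μ(o↔v) > 2` and `t ≥ μ(o↮v)` (all `v`):
`μ{o reaches at most one of a,b,c} ≤ t`.  Here it is PROVED whenever `o, a, b, c` exhaust the vertex set (`∀ u, u = o ∨ u = a ∨ u = b ∨ u = c`),
i.e. for `K4` with six arbitrary weights (`ThreePort.le_one_reached_le_K4`), and hence in `ZeroOneThree`'s own shape for every `n ≤ 4`
(`ThreePort.zeroOneThree_of_card_le_four`) — the first complete graph class containing a second-order-tight family (`W4`, memo §12.1).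

Part 1 (`…QuantZeroOneK4Cells`): reachability/cells of the triangle and the residual real inequality `k4_residual_false`.
PROOF (memo §13.10; hairs `α, β, γ` at `o`, triangle `x = w(ab)`, `y = w(ac)`, `z = w(bc)`, bars for `1 − ·`).  The three-point cells of the
triangle off `o` are cylinders: `U0 = x̄ȳz̄`, `μ{b~c, ¬a~b} = z x̄ȳ` etc. (`real_allApart_K4`, `real_pairOnly_K4`).  If the pocket exchange
`μ(B={v}) ≤ μ(B = the other two)` held at SOME apex `v` we would be done (`measureReal_le_one_le_compl_of_exchange`).  If it fails at all
three apexes, `ThreePort.margin_eq` at each apex gives  `z·c_z < T⁻`, `y·c_y < W_b`, `x·c_x < W_c`  with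
`c_z = ᾱ(β+γ−2βγ)`, `c_y = β̄(α+γ−2αγ)`, `c_x = γ̄(α+β−2αβ)`, `T⁻ = αβ̄γ̄ − ᾱβγ`, `W_b = ᾱβγ̄ − αβ̄γ`, `W_c = ᾱγβ̄ − αγ̄β`;
in particular all hairs are `< ½` (`T⁻ + W_c = (1−2β)·(αγ̄+ᾱγ)` etc.).  First-moment counting (`Quant.sum_conn_le_layer_split`) gives
`Σ ≤ 3 − 3μ(N=0) − 2μ(N=1)` with `μ(N=0) ≥ ᾱβ̄γ̄` and `μ(N=1) ≥ αβ̄γ̄x̄ȳ + ᾱβγ̄x̄z̄ + ᾱβ̄γȳz̄`; using `x̄ȳ ≥ 1−x−y` and the three caps,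
`3μ(N=0) + 2μ(N=1) ≥ 1 + (1−2α)(1−2β)(1−2γ) + ᾱβ̄γ̄ > 1`, i.e. `Σ < 2` — contradicting `Σ > 2`.
[cite: KozmaNitzan2024, Lemma 2 (p. 6)] (context: level 1 of the family); the statement `Z(3,2)` itself is this programme's.
-/

noncomputable section

namespace Summit.CriticalPhenomena.PercolationContinuityZ3.Theorems

open MeasureTheory Set Literature.Probability.LatticeModels Literature.Probability.Percolation
open scoped Classical BigOperators

variable {n : ℕ}

namespace ThreePort

/-! ### `Z(3,2)` on `K4` -/

/-- **`Z(3,2)` holds on every weighted graph whose vertices are `o, a, b, c`** (all graphs on at most four vertices; `K4` with six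
arbitrary weights).  For `R = {a, b, c}`, `Σ_v μ(o↔v) > 2` and `t ≥ μ(o↮v)` for each `v ∈ R`: `μ{o reaches at most one vertex of R} ≤ t`
— the conclusion of `OneCutFive.ZeroOneThree`.  Proof: if the pocket exchange holds at some apex, `measureReal_le_one_le_compl_of_exchange`;
otherwise `ThreePort.margin_eq` at the three apexes, the triangle cells, first-moment counting (`Quant.sum_conn_le_layer_split`,
`ThreePort.real_starEvent`, `ThreePort.real_single`) and `k4_residual_false` contradict `Σ > 2`. [this work] -/
theorem le_one_reached_le_K4 (w : Sym2 (Fin n) → unitInterval) (R : Finset (Fin n)) (o a b c : Fin n) (t : ℝ)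
    (hR : R = {a, b, c}) (hao : a ≠ o) (hbo : b ≠ o) (hco : c ≠ o) (hab : a ≠ b) (hac : a ≠ c) (hbc : b ≠ c)
    (huniv : ∀ u : Fin n, u = o ∨ u = a ∨ u = b ∨ u = c)
    (hsum : 2 < (prodBernoulli w).real (openConn o a) + (prodBernoulli w).real (openConn o b) +
      (prodBernoulli w).real (openConn o c))
    (hta : (prodBernoulli w).real (openConn o a)ᶜ ≤ t) (htb : (prodBernoulli w).real (openConn o b)ᶜ ≤ t)
    (htc : (prodBernoulli w).real (openConn o c)ᶜ ≤ t) :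
    (prodBernoulli w).real {ω : BondConfig (Fin n) | (R.filter fun v => ω ∈ openConn o v).card ≤ 1} ≤ t := by
  have ha : a ∈ R := by simp [hR]
  have hb : b ∈ R := by simp [hR]
  have hc : c ∈ R := by simp [hR]
  -- exchange at some apex suffices
  by_cases hA : (prodBernoulli w).real {ω | ω ∈ openConn o a ∧ ω ∉ openConn o b ∧ ω ∉ openConn o c} ≤
      (prodBernoulli w).real {ω | ω ∉ openConn o a ∧ ω ∈ openConn o b ∧ ω ∈ openConn o c}
  · exact (OneCutFive.measureReal_le_one_le_compl_of_exchange w R o a b c ha hb hc hab hac hbc hA).trans hta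
  by_cases hB : (prodBernoulli w).real {ω | ω ∈ openConn o b ∧ ω ∉ openConn o a ∧ ω ∉ openConn o c} ≤
      (prodBernoulli w).real {ω | ω ∉ openConn o b ∧ ω ∈ openConn o a ∧ ω ∈ openConn o c}
  · exact (OneCutFive.measureReal_le_one_le_compl_of_exchange w R o b a c hb ha hc hab.symm hbc hac hB).trans htb
  by_cases hC : (prodBernoulli w).real {ω | ω ∈ openConn o c ∧ ω ∉ openConn o a ∧ ω ∉ openConn o b} ≤
      (prodBernoulli w).real {ω | ω ∉ openConn o c ∧ ω ∈ openConn o a ∧ ω ∈ openConn o b}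
  · exact (OneCutFive.measureReal_le_one_le_compl_of_exchange w R o c a b hc ha hb hac.symm hbc.symm hab hC).trans htc
  exfalso
  push Not at hA hB hC
  -- three-port hypotheses (vacuous: there is no fifth vertex)
  have hobs : ∀ u, u ≠ o → u ≠ a → u ≠ b → u ≠ c → w s(o, u) = 0 := by
    intro u h1 h2 h3 h4; rcases huniv u with h | h | h | h <;> contradiction
  have hobs' : ∀ u, u ≠ o → u ≠ b → u ≠ a → u ≠ c → w s(o, u) = 0 :=
    fun u h1 h2 h3 h4 => hobs u h1 h3 h2 h4
  have hobs'' : ∀ u, u ≠ o → u ≠ c → u ≠ a → u ≠ b → w s(o, u) = 0 :=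
    fun u h1 h2 h3 h4 => hobs u h1 h3 h4 h2
  have hunivB : ∀ u : Fin n, u = o ∨ u = b ∨ u = a ∨ u = c := fun u => by rcases huniv u with h | h | h | h <;> simp [h]
  have hunivC : ∀ u : Fin n, u = o ∨ u = c ∨ u = a ∨ u = b := fun u => by rcases huniv u with h | h | h | h <;> simp [h]
  -- margins at the three apexes
  have hma := margin_eq w o a b c hao hbo hco hab hac hbc hobs
  have hmb := margin_eq w o b a c hbo hao hco hab.symm hbc hac hobs'
  have hmc := margin_eq w o c a b hco hao hbo hac.symm hbc.symm hab hobs''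
  -- singles at the three apexes
  have hsa := real_single w o a b c hao hbo hco hab hac hbc hobs
  have hsb := real_single w o b a c hbo hao hco hab.symm hbc hac hobs'
  have hsc := real_single w o c a b hco hao hbo hac.symm hbc.symm hab hobs''
  -- triangle cells
  rw [real_allApart_K4 w o a b c hao hbo hco hab hac hbc huniv, real_pairOnly_K4 w o a b c hao hbo hco hab hac hbc huniv] at hma hsa
  rw [real_allApart_K4 w o b a c hbo hao hco hab.symm hbc hac hunivB,
    real_pairOnly_K4 w o b a c hbo hao hco hab.symm hbc hac hunivB] at hmb hsb
  rw [real_allApart_K4 w o c a b hco hao hbo hac.symm hbc.symm hab hunivC,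
    real_pairOnly_K4 w o c a b hco hao hbo hac.symm hbc.symm hab hunivC] at hmc hsc
  have sba : s(b, a) = s(a, b) := Sym2.eq_swap
  have sca : s(c, a) = s(a, c) := Sym2.eq_swap
  have scb : s(c, b) = s(b, c) := Sym2.eq_swap
  rw [sba] at hmb hsb
  rw [sca, scb] at hmc hsc
  -- abbreviations
  set μ := prodBernoulli w with hμ
  set α : ℝ := (w s(o, a) : ℝ) with hα
  set β : ℝ := (w s(o, b) : ℝ) with hβ
  set γ : ℝ := (w s(o, c) : ℝ) with hγ
  set x : ℝ := (w s(a, b) : ℝ) with hx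
  set y : ℝ := (w s(a, c) : ℝ) with hy
  set z : ℝ := (w s(b, c) : ℝ) with hz
  have hα0 : 0 ≤ α := unitInterval.nonneg _
  have hα1 : α ≤ 1 := unitInterval.le_one _
  have hβ0 : 0 ≤ β := unitInterval.nonneg _
  have hβ1 : β ≤ 1 := unitInterval.le_one _
  have hγ0 : 0 ≤ γ := unitInterval.nonneg _
  have hγ1 : γ ≤ 1 := unitInterval.le_one _
  have hx0 : 0 ≤ x := unitInterval.nonneg _
  have hx1 : x ≤ 1 := unitInterval.le_one _
  have hy0 : 0 ≤ y := unitInterval.nonneg _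
  have hy1 : y ≤ 1 := unitInterval.le_one _
  have hz0 : 0 ≤ z := unitInterval.nonneg _
  have hz1 : z ≤ 1 := unitInterval.le_one _
  -- the three failed exchanges in closed form (divide out the nonnegative prefactors)
  have ga : (1 - z) * ((1 - α) * β * γ - α * (1 - β) * (1 - γ)) + z * (β + γ - β * γ - α) < 0 := by
    have e : μ.real {ω | ω ∉ openConn o a ∧ ω ∈ openConn o b ∧ ω ∈ openConn o c} -
        μ.real {ω | ω ∈ openConn o a ∧ ω ∉ openConn o b ∧ ω ∉ openConn o c} =
        (1 - x) * (1 - y) * ((1 - z) * ((1 - α) * β * γ - α * (1 - β) * (1 - γ)) + z * (β + γ - β * γ - α)) := by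
      rw [hma]; ring
    by_contra h
    push Not at h
    have : 0 ≤ (1 - x) * (1 - y) * ((1 - z) * ((1 - α) * β * γ - α * (1 - β) * (1 - γ)) + z * (β + γ - β * γ - α)) :=
      mul_nonneg (mul_nonneg (by linarith) (by linarith)) h
    linarith
  have gb : (1 - y) * ((1 - β) * α * γ - β * (1 - α) * (1 - γ)) + y * (α + γ - α * γ - β) < 0 := by
    have e : μ.real {ω | ω ∉ openConn o b ∧ ω ∈ openConn o a ∧ ω ∈ openConn o c} -
        μ.real {ω | ω ∈ openConn o b ∧ ω ∉ openConn o a ∧ ω ∉ openConn o c} =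
        (1 - x) * (1 - z) * ((1 - y) * ((1 - β) * α * γ - β * (1 - α) * (1 - γ)) + y * (α + γ - α * γ - β)) := by
      rw [hmb]; ring
    by_contra h
    push Not at h
    have : 0 ≤ (1 - x) * (1 - z) * ((1 - y) * ((1 - β) * α * γ - β * (1 - α) * (1 - γ)) + y * (α + γ - α * γ - β)) :=
      mul_nonneg (mul_nonneg (by linarith) (by linarith)) h
    linarith
  have gc : (1 - x) * ((1 - γ) * α * β - γ * (1 - α) * (1 - β)) + x * (α + β - α * β - γ) < 0 := by
    have e : μ.real {ω | ω ∉ openConn o c ∧ ω ∈ openConn o a ∧ ω ∈ openConn o b} -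
        μ.real {ω | ω ∈ openConn o c ∧ ω ∉ openConn o a ∧ ω ∉ openConn o b} =
        (1 - y) * (1 - z) * ((1 - x) * ((1 - γ) * α * β - γ * (1 - α) * (1 - β)) + x * (α + β - α * β - γ)) := by
      rw [hmc]; ring
    by_contra h
    push Not at h
    have : 0 ≤ (1 - y) * (1 - z) * ((1 - x) * ((1 - γ) * α * β - γ * (1 - α) * (1 - β)) + x * (α + β - α * β - γ)) :=
      mul_nonneg (mul_nonneg (by linarith) (by linarith)) h
    linarith
  -- counting: Σ ≤ μ{N = 1} + 3 μ{N ≥ 2}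
  have hsplit := Quant.sum_conn_le_layer_split w R o 1
  have hRsum : ∑ v ∈ R, μ.real (openConn o v : Set (BondConfig (Fin n))) =
      μ.real (openConn o a) + μ.real (openConn o b) + μ.real (openConn o c) := by
    rw [hR, Finset.sum_insert (by simp [hab, hac]), Finset.sum_insert (by simp [hbc]), Finset.sum_singleton]
    ring
  have hRcard : (R.card : ℝ) = 3 := by
    rw [hR, Finset.card_eq_three.2 ⟨a, b, c, hab, hac, hbc, rfl⟩]; norm_num
  rw [← hμ, hRsum, hRcard] at hsplit
  set S0 : Set (BondConfig (Fin n)) := {ω | (R.filter fun v => ω ∈ openConn o v).card = 0} with hS0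
  set S1 : Set (BondConfig (Fin n)) := {ω | 1 ≤ (R.filter fun v => ω ∈ openConn o v).card ∧
      (R.filter fun v => ω ∈ openConn o v).card ≤ 1} with hS1
  set S2 : Set (BondConfig (Fin n)) := {ω | 1 + 1 ≤ (R.filter fun v => ω ∈ openConn o v).card} with hS2
  have hmeas : ∀ S : Set (BondConfig (Fin n)), MeasurableSet S := fun S => (Set.toFinite S).measurableSet
  -- μ S2 ≤ 1 − μ S0 − μ S1
  have hdisj01 : Disjoint S0 S1 := by
    rw [Set.disjoint_left]; rintro ω h0 ⟨h1, -⟩; simp only [hS0, Set.mem_setOf_eq] at h0; omega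
  have hsub : S0 ∪ S1 ⊆ S2ᶜ := by
    rintro ω (h | ⟨-, h⟩) h2 <;> simp only [hS0, hS2, Set.mem_setOf_eq] at h h2 <;> omega
  have hS2le : μ.real S2 ≤ 1 - μ.real S0 - μ.real S1 := by
    have h1 : μ.real S0 + μ.real S1 ≤ μ.real S2ᶜ := by
      rw [← measureReal_union hdisj01 (hmeas _)]; exact measureReal_mono hsub (measure_ne_top _ _)
    rw [probReal_compl_eq_one_sub (hmeas _)] at h1
    linarith
  -- μ S0 ≥ (1−α)(1−β)(1−γ): all hairs closed isolates `o`
  have hstar := real_starEvent w o a b c hao hbo hco hab hac hbc hobs ∅ (Finset.empty_subset _)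
  simp only [Finset.notMem_empty, if_false] at hstar
  have hS0low : (1 - α) * (1 - β) * (1 - γ) ≤ μ.real S0 := by
    rw [hμ, ← hstar]
    refine measureReal_mono (fun ω hω => ?_) (measure_ne_top _ _)
    rw [Finset.coe_empty, mem_starEvent_iff] at hω
    show (R.filter fun v => ω ∈ openConn o v).card = 0
    rw [Finset.card_eq_zero, Finset.filter_eq_empty_iff]
    intro v hv hreach
    have hvo : v ≠ o := by
      rw [hR] at hv; simp only [Finset.mem_insert, Finset.mem_singleton] at hv
      rcases hv with rfl | rfl | rfl <;> assumption
    have hiso : ∀ q, ¬ (openGraph ω).Adj o q := by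
      intro q hq
      rw [openGraph_adj] at hq
      exact Set.notMem_empty q ((hω q (fun h => hq.2 h.symm)).1 hq.1)
    exact not_reachable_of_isolated (openGraph ω) o v hiso (Ne.symm hvo) hreach
  -- μ S1 ≥ s_a + s_b + s_c: the three single-pocket events are disjoint pieces of S1
  set Ea : Set (BondConfig (Fin n)) := {ω | ω ∈ openConn o a ∧ ω ∉ openConn o b ∧ ω ∉ openConn o c} with hEa
  set Eb : Set (BondConfig (Fin n)) := {ω | ω ∈ openConn o b ∧ ω ∉ openConn o a ∧ ω ∉ openConn o c} with hEb
  set Ec : Set (BondConfig (Fin n)) := {ω | ω ∈ openConn o c ∧ ω ∉ openConn o a ∧ ω ∉ openConn o b} with hEc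
  have hmemR : ∀ v, v ∈ R ↔ (v = a ∨ v = b ∨ v = c) := fun v => by rw [hR]; simp
  have hS1_of : ∀ (ω : BondConfig (Fin n)) (p : Fin n), p ∈ R → ω ∈ openConn o p →
      (∀ q ∈ R, ω ∈ openConn o q → q = p) → ω ∈ S1 := by
    intro ω p hp hωp huniq
    have hfilt : (R.filter fun v => ω ∈ openConn o v) = {p} := by
      ext v
      simp only [Finset.mem_filter, Finset.mem_singleton]
      constructor
      · rintro ⟨hv, hωv⟩; exact huniq v hv hωv
      · rintro rfl; exact ⟨hp, hωp⟩
    show 1 ≤ (R.filter fun v => ω ∈ openConn o v).card ∧ (R.filter fun v => ω ∈ openConn o v).card ≤ 1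
    rw [hfilt, Finset.card_singleton]; omega
  have hEaS : Ea ⊆ S1 := fun ω hω => hS1_of ω a ha hω.1 fun q hq hωq => by
    rcases (hmemR q).1 hq with rfl | rfl | rfl
    · rfl
    · exact absurd hωq hω.2.1
    · exact absurd hωq hω.2.2
  have hEbS : Eb ⊆ S1 := fun ω hω => hS1_of ω b hb hω.1 fun q hq hωq => by
    rcases (hmemR q).1 hq with rfl | rfl | rfl
    · exact absurd hωq hω.2.1
    · rfl
    · exact absurd hωq hω.2.2
  have hEcS : Ec ⊆ S1 := fun ω hω => hS1_of ω c hc hω.1 fun q hq hωq => by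
    rcases (hmemR q).1 hq with rfl | rfl | rfl
    · exact absurd hωq hω.2.1
    · exact absurd hωq hω.2.2
    · rfl
  have hdab : Disjoint Ea Eb := by rw [Set.disjoint_left]; rintro ω ⟨h1, -, -⟩ ⟨-, h2, -⟩; exact h2 h1
  have hdabc : Disjoint (Ea ∪ Eb) Ec := by
    rw [Set.disjoint_left]; rintro ω (⟨h1, -, -⟩ | ⟨h1, -, -⟩) ⟨-, h2, h3⟩
    · exact h2 h1
    · exact h3 h1
  have hS1low : μ.real Ea + μ.real Eb + μ.real Ec ≤ μ.real S1 := by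
    rw [← measureReal_union hdab (hmeas _), ← measureReal_union hdabc (hmeas _)]
    exact measureReal_mono (Set.union_subset (Set.union_subset hEaS hEbS) hEcS) (measure_ne_top _ _)
  -- the singles in closed form
  have hEa_eq : μ.real Ea = α * (1 - β) * (1 - γ) * ((1 - x) * (1 - y)) := by rw [hEa, hsa]; ring
  have hEb_eq : μ.real Eb = (1 - α) * β * (1 - γ) * ((1 - x) * (1 - z)) := by rw [hEb, hsb]; ring
  have hEc_eq : μ.real Ec = (1 - α) * (1 - β) * γ * ((1 - y) * (1 - z)) := by rw [hEc, hsc]; ring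
  -- assemble: Σ > 2 forces 3 μS0 + 2 μS1 < 1, contradicting the residual inequality
  have hS0nn : 0 ≤ μ.real S0 := measureReal_nonneg
  have hS1nn : 0 ≤ μ.real S1 := measureReal_nonneg
  have hS2nn : 0 ≤ μ.real S2 := measureReal_nonneg
  refine k4_residual_false α β γ x y z hα0 hα1 hβ0 hβ1 hγ0 hγ1 hx0 hy0 hz0 ga gb gc ?_
  rw [← hEa_eq, ← hEb_eq, ← hEc_eq]
  simp only [Nat.cast_one, one_mul] at hsplit
  linarith

/-- **`OneCutFive.ZeroOneThree` for every weighted graph on at most four vertices** (its exact shape, `n ≤ 4`): for `R` with `|R| = 3`,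
`Σ_{v∈R} μ(o↔v) > 2` and `μ(o↮v) ≤ t` on `R`, `μ{o reaches at most one vertex of R} ≤ t`.  If `o ∈ R` this is trivial (`o` reaches itself,
so the event forces `o ↮ v` for the other `v ∈ R`); if `o ∉ R` then `R ∪ {o}` is the whole vertex set and `le_one_reached_le_K4` applies. [this work] -/
theorem zeroOneThree_of_card_le_four (hn : n ≤ 4) (w : Sym2 (Fin n) → unitInterval) (R : Finset (Fin n)) (o : Fin n) (t : ℝ)
    (hR3 : R.card = 3) (hsum : 2 < ∑ v ∈ R, (prodBernoulli w).real (openConn o v))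
    (hcut : ∀ v ∈ R, (prodBernoulli w).real (openConn o v)ᶜ ≤ t) :
    (prodBernoulli w).real {ω : BondConfig (Fin n) | (R.filter fun v => ω ∈ openConn o v).card ≤ 1} ≤ t := by
  by_cases hoR : o ∈ R
  · -- trivial case: some `v ∈ R`, `v ≠ o`, and `{card ≤ 1} ⊆ {o ↮ v}`
    obtain ⟨v, hvR, hvo⟩ : ∃ v ∈ R, v ≠ o := by
      have : 1 < R.card := by omega
      obtain ⟨v, hv, hne⟩ := Finset.exists_mem_ne this o
      exact ⟨v, hv, hne⟩
    have hsub : {ω : BondConfig (Fin n) | (R.filter fun v => ω ∈ openConn o v).card ≤ 1} ⊆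
        (openConn o v : Set (BondConfig (Fin n)))ᶜ := by
      intro ω hω hωv
      have hoF : o ∈ R.filter fun u => ω ∈ openConn o u :=
        Finset.mem_filter.2 ⟨hoR, (SimpleGraph.Reachable.refl o : (openGraph ω).Reachable o o)⟩
      have hvF : v ∈ R.filter fun u => ω ∈ openConn o u := Finset.mem_filter.2 ⟨hvR, hωv⟩
      have h2 : 1 < (R.filter fun u => ω ∈ openConn o u).card := Finset.one_lt_card.2 ⟨v, hvF, o, hoF, hvo⟩
      have h1 : (R.filter fun u => ω ∈ openConn o u).card ≤ 1 := hω
      omega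
    exact (measureReal_mono hsub (measure_ne_top _ _)).trans (hcut v hvR)
  · -- `R ∪ {o}` exhausts the vertex set
    obtain ⟨a, b, c, hab, hac, hbc, hRabc⟩ := Finset.card_eq_three.1 hR3
    have hcardI : (insert o R).card = 4 := by rw [Finset.card_insert_of_notMem hoR, hR3]
    have hle : (insert o R).card ≤ Fintype.card (Fin n) := Finset.card_le_univ _
    rw [Fintype.card_fin] at hle
    have hn4 : n = 4 := by omega
    have huniv_set : insert o R = Finset.univ :=
      Finset.eq_univ_of_card _ (by rw [hcardI, Fintype.card_fin, hn4])
    have huniv : ∀ u : Fin n, u = o ∨ u = a ∨ u = b ∨ u = c := by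
      intro u
      have hu : u ∈ insert o R := by rw [huniv_set]; exact Finset.mem_univ u
      rw [Finset.mem_insert, hRabc] at hu
      simpa [Finset.mem_insert, Finset.mem_singleton] using hu
    have hao : a ≠ o := fun h => hoR (by rw [hRabc, ← h]; simp)
    have hbo : b ≠ o := fun h => hoR (by rw [hRabc, ← h]; simp)
    have hco : c ≠ o := fun h => hoR (by rw [hRabc, ← h]; simp)
    have hsum' : 2 < (prodBernoulli w).real (openConn o a) + (prodBernoulli w).real (openConn o b) +
        (prodBernoulli w).real (openConn o c) := by
      rw [hRabc, Finset.sum_insert (by simp [hab, hac]), Finset.sum_insert (by simp [hbc]), Finset.sum_singleton] at hsum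
      linarith
    have ha : a ∈ R := by rw [hRabc]; simp
    have hb : b ∈ R := by rw [hRabc]; simp
    have hc : c ∈ R := by rw [hRabc]; simp
    exact le_one_reached_le_K4 w R o a b c t hRabc hao hbo hco hab hac hbc huniv hsum' (hcut a ha) (hcut b hb) (hcut c hc)

end ThreePort

end Summit.CriticalPhenomena.PercolationContinuityZ3.Theorems

end
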